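import Mathlib.Analysis.SpecialFunctions.Log.Base
import Literature.Computability.AlgebraicComplexity.QuantumFunctionals
import HarnessLib

/-!
# Proof of CVZ Thm. 3.19.5: the dimension bounds on the quantum functionals

Topic `Literature/Computability/AlgebraicComplexity`; a sibling proofs file of `QuantumFunctionals.lean`
(next to `QuantumFunctionalsProofs.lean`, which discharges the normalisation Thm. 3.19.1) discharging its
named fact `ChristandlVranaZuiddam2023_bounds` (`ChristandlVranaZuiddam2023_bounds_holds`):
for every `θ ∈ P([3])` and every complex 3-tensor `t ∈ ℂ^ι ⊗ ℂ^κ ⊗ ℂ^μ` over finite index types,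
`0 ≤ F^θ(t) ≤ min(|ι|,|κ||μ|)^{θ(1)} · min(|κ|,|ι||μ|)^{θ(2)} · min(|μ|,|ι||κ|)^{θ(3)}`.

Source: M. Christandl, P. Vrana, J. Zuiddam, *Universal points in the asymptotic spectrum of tensors*,
J. Amer. Math. Soc. 36 (2023) = arXiv:1709.07851v3, Thm. 3.19.5
("`0 ≤ F_θ(s) ≤ ∏_{{S,S̄} ∈ B} min{dim V_S, dim V_S̄}^{θ({S,S̄})}`"; "Statement 5 is easy to prove"), with
the argument printed in Ex. 3.18: "the quantum entropy of a density matrix `ρ` is at most [`log₂` of] the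
matrix rank of `ρ`. Therefore `H(|ψ⟩⟨ψ|_S) ≤ log₂ rank(|ψ⟩⟨ψ|_S) ≤ log₂ R_S(ψ)`", `R_S` the flattening
rank, which is at most `min(dim V_S, dim V_S̄)`. For `k = 3` the bipartitions are `{j} | [3]∖{j}` and
`dim V_{[3]∖{j}}` is the product of the other two dimensions.

## Proof architecture (as printed, case `k = 3`)

* `shannonEntropy_le_log_card_subtype` — a probability vector supported in `{x | p x}` has
  `H(P) ≤ log₂ |{x | p x}|` (restrict to the subtype; `shannonEntropy_le_of_mem_stdSimplex`).
* `rank_reducedDensity₁/₂/₃_le` — `rank |t⟩⟨t|_j = rank (M_j M_jᴴ) ≤ rank M_j ≤ |V_{[3]∖{j}}|` and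
  `≤ |V_j|`, `M_j` the `j`-th flattening (`Matrix.rank_mul_le_left`, `Matrix.rank_le_card_width/height`).
* `shannonEntropy_marginalSpectrum₁/₂/₃_le` — for `t ≠ 0` the normalised spectrum `r_j(t)` of
  `|t⟩⟨t|_j` is supported on the nonzero eigenvalues, and there are `rank |t⟩⟨t|_j` of them
  (`Matrix.IsHermitian.rank_eq_card_non_zero_eigs`); hence `H(r_j(t)) ≤ log₂ min(|V_j|, |V_{[3]∖{j}}|)`.
* `quantumEntropy_le_log_min`, `logQuantumFunctional_le_log_min` — weight by `θ ≥ 0`, and pass to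
  the supremum over `GL × GL × GL` (the bound depends only on the format).
* `ChristandlVranaZuiddam2023_bounds_holds` — exponentiate, `2^{∑ⱼ θ(j) log₂ mⱼ} = ∏ⱼ mⱼ^{θ(j)}`
  (`two_rpow_mul_log_div_log`); `F^θ(0) = 0` is below a product of nonnegative powers.

No definitions are introduced and nothing of `QuantumFunctionals.lean` is restated.
-/

noncomputable section

open scoped BigOperators Matrix
open Real (negMulLog)

namespace Literature.Computability.AlgebraicComplexity

universe u

/-! ## Entropy of a distribution with restricted support -/

section Entropy

variable {α : Type*} [Fintype α]

/-- A probability vector `P` vanishing outside `{x | p x}` has Shannon entropy at most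
`log₂ |{x | p x}|`: its entropy is the entropy of its restriction to the subtype, which is a
probability vector there. [folklore] -/
theorem shannonEntropy_le_log_card_subtype {P : α → ℝ} (hP : P ∈ stdSimplex ℝ α) (p : α → Prop)
    [DecidablePred p] (hp : ∀ x, P x ≠ 0 → p x) :
    shannonEntropy P ≤ Real.log (Fintype.card {x // p x}) / Real.log 2 := by
  -- sums over `α` of quantities vanishing where `P` does are sums over the subtype
  have hsum : ∀ g : ℝ → ℝ, g 0 = 0 → ∑ a, g (P a) = ∑ a : {x // p x}, g (P a) := fun g hg => by
    rw [← Finset.sum_filter_of_ne (s := Finset.univ) (f := fun a => g (P a)) (p := p)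
      (fun x _ hx => hp x fun h0 => hx (by simp only [h0, hg]))]
    exact Finset.sum_subtype _ (fun x => by simp) _
  have hQ : (fun a : {x // p x} => P a) ∈ stdSimplex ℝ {x // p x} :=
    ⟨fun a => hP.1 a, show ∑ a : {x // p x}, P a = 1 by rw [← hsum (fun y => y) rfl]; exact hP.2⟩
  calc shannonEntropy P = shannonEntropy (fun a : {x // p x} => P a) := by
        rw [shannonEntropy_def, shannonEntropy_def, hsum negMulLog Real.negMulLog_zero]
    _ ≤ Real.log (Fintype.card {x // p x}) / Real.log 2 := shannonEntropy_le_of_mem_stdSimplex hQ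

/-- `2^{θ · log₂ m} = m^θ` for `m > 0`. [folklore] -/
theorem two_rpow_mul_log_div_log {m : ℝ} (hm : 0 < m) (θ : ℝ) :
    (2 : ℝ) ^ (θ * (Real.log m / Real.log 2)) = m ^ θ := by
  rw [mul_comm, Real.rpow_mul zero_le_two]
  congr 1
  exact Real.rpow_logb two_pos (by norm_num) hm

end Entropy

/-! ## Ranks of the reduced density matrices and entropies of the marginal spectra -/

section Marginals

variable {ι κ μ : Type*} [Fintype ι] [Fintype κ] [Fintype μ]

/-- `rank |t⟩⟨t|₁ ≤ min(|ι|, |κ||μ|)`: `|t⟩⟨t|₁ = M Mᴴ` for the `|ι| × |κ||μ|` flattening `M` of `t`,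
so its rank is at most `rank M ≤ |κ × μ|` and at most its own size `|ι|`. [folklore] -/
theorem rank_reducedDensity₁_le (t : ι → κ → μ → ℂ) :
    (reducedDensity₁ t).rank ≤ min (Fintype.card ι) (Fintype.card κ * Fintype.card μ) :=
  le_min (Matrix.rank_le_card_height _) ((Matrix.rank_mul_le_left _ _).trans
    ((Matrix.rank_le_card_width _).trans_eq (Fintype.card_prod _ _)))

/-- `rank |t⟩⟨t|₂ ≤ min(|κ|, |ι||μ|)` (flattening `κ × (ι × μ)`). [folklore] -/
theorem rank_reducedDensity₂_le (t : ι → κ → μ → ℂ) :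
    (reducedDensity₂ t).rank ≤ min (Fintype.card κ) (Fintype.card ι * Fintype.card μ) :=
  le_min (Matrix.rank_le_card_height _) ((Matrix.rank_mul_le_left _ _).trans
    ((Matrix.rank_le_card_width _).trans_eq (Fintype.card_prod _ _)))

/-- `rank |t⟩⟨t|₃ ≤ min(|μ|, |ι||κ|)` (flattening `μ × (ι × κ)`). [folklore] -/
theorem rank_reducedDensity₃_le (t : ι → κ → μ → ℂ) :
    (reducedDensity₃ t).rank ≤ min (Fintype.card μ) (Fintype.card ι * Fintype.card κ) :=
  le_min (Matrix.rank_le_card_height _) ((Matrix.rank_mul_le_left _ _).trans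
    ((Matrix.rank_le_card_width _).trans_eq (Fintype.card_prod _ _)))

/-- `H(r₁(t)) ≤ log₂ min(|ι|, |κ||μ|)` for `t ≠ 0`: the normalised spectrum `r₁(t)` of `|t⟩⟨t|₁` is
supported on the nonzero eigenvalues, of which there are `rank |t⟩⟨t|₁ ≤ min(|ι|, |κ||μ|)`
(CVZ Ex. 3.18: "the quantum entropy of a density matrix is at most [`log₂` of] its matrix rank").
[cite: ChristandlVranaZuiddam2023, Ex. 3.18] -/
theorem shannonEntropy_marginalSpectrum₁_le [DecidableEq ι] {t : ι → κ → μ → ℂ} (ht : t ≠ 0) :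
    shannonEntropy (marginalSpectrum₁ t) ≤
      Real.log (min (Fintype.card ι) (Fintype.card κ * Fintype.card μ) : ℝ) / Real.log 2 := by
  have hsupp : ∀ i, marginalSpectrum₁ t i ≠ 0 → (isHermitian_reducedDensity₁ t).eigenvalues i ≠ 0 :=
    fun i hi h0 => hi (show (isHermitian_reducedDensity₁ t).eigenvalues i / tensorNormSq t = 0 by
      rw [h0, zero_div])
  obtain ⟨i₀, hi₀⟩ : ∃ i, marginalSpectrum₁ t i ≠ 0 := by
    by_contra h
    push Not at h
    have h1 := (marginalSpectrum₁_mem_stdSimplex ht).2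
    rw [Fintype.sum_eq_zero _ h] at h1
    exact zero_ne_one h1
  have hcard : (Fintype.card {i // (isHermitian_reducedDensity₁ t).eigenvalues i ≠ 0} : ℝ) ≤
      (min (Fintype.card ι) (Fintype.card κ * Fintype.card μ) : ℝ) := by
    have h := rank_reducedDensity₁_le t
    rw [(isHermitian_reducedDensity₁ t).rank_eq_card_non_zero_eigs] at h
    exact_mod_cast h
  have hpos : (0 : ℝ) < Fintype.card {i // (isHermitian_reducedDensity₁ t).eigenvalues i ≠ 0} :=
    Nat.cast_pos.2 (Fintype.card_pos_iff.2 ⟨⟨i₀, hsupp i₀ hi₀⟩⟩)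
  exact (shannonEntropy_le_log_card_subtype (marginalSpectrum₁_mem_stdSimplex ht)
    (fun i => (isHermitian_reducedDensity₁ t).eigenvalues i ≠ 0) hsupp).trans
    (div_le_div_of_nonneg_right (Real.log_le_log hpos hcard) (Real.log_nonneg one_le_two))

/-- `H(r₂(t)) ≤ log₂ min(|κ|, |ι||μ|)` for `t ≠ 0` (as `shannonEntropy_marginalSpectrum₁_le`).
[cite: ChristandlVranaZuiddam2023, Ex. 3.18] -/
theorem shannonEntropy_marginalSpectrum₂_le [DecidableEq κ] {t : ι → κ → μ → ℂ} (ht : t ≠ 0) :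
    shannonEntropy (marginalSpectrum₂ t) ≤
      Real.log (min (Fintype.card κ) (Fintype.card ι * Fintype.card μ) : ℝ) / Real.log 2 := by
  have hsupp : ∀ i, marginalSpectrum₂ t i ≠ 0 → (isHermitian_reducedDensity₂ t).eigenvalues i ≠ 0 :=
    fun i hi h0 => hi (show (isHermitian_reducedDensity₂ t).eigenvalues i / tensorNormSq t = 0 by
      rw [h0, zero_div])
  obtain ⟨i₀, hi₀⟩ : ∃ i, marginalSpectrum₂ t i ≠ 0 := by
    by_contra h
    push Not at h
    have h1 := (marginalSpectrum₂_mem_stdSimplex ht).2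
    rw [Fintype.sum_eq_zero _ h] at h1
    exact zero_ne_one h1
  have hcard : (Fintype.card {i // (isHermitian_reducedDensity₂ t).eigenvalues i ≠ 0} : ℝ) ≤
      (min (Fintype.card κ) (Fintype.card ι * Fintype.card μ) : ℝ) := by
    have h := rank_reducedDensity₂_le t
    rw [(isHermitian_reducedDensity₂ t).rank_eq_card_non_zero_eigs] at h
    exact_mod_cast h
  have hpos : (0 : ℝ) < Fintype.card {i // (isHermitian_reducedDensity₂ t).eigenvalues i ≠ 0} :=
    Nat.cast_pos.2 (Fintype.card_pos_iff.2 ⟨⟨i₀, hsupp i₀ hi₀⟩⟩)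
  exact (shannonEntropy_le_log_card_subtype (marginalSpectrum₂_mem_stdSimplex ht)
    (fun i => (isHermitian_reducedDensity₂ t).eigenvalues i ≠ 0) hsupp).trans
    (div_le_div_of_nonneg_right (Real.log_le_log hpos hcard) (Real.log_nonneg one_le_two))

/-- `H(r₃(t)) ≤ log₂ min(|μ|, |ι||κ|)` for `t ≠ 0` (as `shannonEntropy_marginalSpectrum₁_le`).
[cite: ChristandlVranaZuiddam2023, Ex. 3.18] -/
theorem shannonEntropy_marginalSpectrum₃_le [DecidableEq μ] {t : ι → κ → μ → ℂ} (ht : t ≠ 0) :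
    shannonEntropy (marginalSpectrum₃ t) ≤
      Real.log (min (Fintype.card μ) (Fintype.card ι * Fintype.card κ) : ℝ) / Real.log 2 := by
  have hsupp : ∀ i, marginalSpectrum₃ t i ≠ 0 → (isHermitian_reducedDensity₃ t).eigenvalues i ≠ 0 :=
    fun i hi h0 => hi (show (isHermitian_reducedDensity₃ t).eigenvalues i / tensorNormSq t = 0 by
      rw [h0, zero_div])
  obtain ⟨i₀, hi₀⟩ : ∃ i, marginalSpectrum₃ t i ≠ 0 := by
    by_contra h
    push Not at h
    have h1 := (marginalSpectrum₃_mem_stdSimplex ht).2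
    rw [Fintype.sum_eq_zero _ h] at h1
    exact zero_ne_one h1
  have hcard : (Fintype.card {i // (isHermitian_reducedDensity₃ t).eigenvalues i ≠ 0} : ℝ) ≤
      (min (Fintype.card μ) (Fintype.card ι * Fintype.card κ) : ℝ) := by
    have h := rank_reducedDensity₃_le t
    rw [(isHermitian_reducedDensity₃ t).rank_eq_card_non_zero_eigs] at h
    exact_mod_cast h
  have hpos : (0 : ℝ) < Fintype.card {i // (isHermitian_reducedDensity₃ t).eigenvalues i ≠ 0} :=
    Nat.cast_pos.2 (Fintype.card_pos_iff.2 ⟨⟨i₀, hsupp i₀ hi₀⟩⟩)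
  exact (shannonEntropy_le_log_card_subtype (marginalSpectrum₃_mem_stdSimplex ht)
    (fun i => (isHermitian_reducedDensity₃ t).eigenvalues i ≠ 0) hsupp).trans
    (div_le_div_of_nonneg_right (Real.log_le_log hpos hcard) (Real.log_nonneg one_le_two))

variable [DecidableEq ι] [DecidableEq κ] [DecidableEq μ]

/-- **CVZ Thm. 3.19.5 in logarithmic form, before the supremum**:
`H_θ(t) ≤ θ(1) log₂ min(|ι|,|κ||μ|) + θ(2) log₂ min(|κ|,|ι||μ|) + θ(3) log₂ min(|μ|,|ι||κ|)` for `θ ≥ 0`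
(for `t = 0` the left side is `0` and each `log₂` of a natural number is `≥ 0`).
[cite: ChristandlVranaZuiddam2023, Thm. 3.19.5] -/
theorem quantumEntropy_le_log_min {θ : Fin 3 → ℝ} (hθ : ∀ i, 0 ≤ θ i) (t : ι → κ → μ → ℂ) :
    quantumEntropy θ t ≤
      θ 0 * (Real.log (min (Fintype.card ι) (Fintype.card κ * Fintype.card μ) : ℝ) / Real.log 2) +
      θ 1 * (Real.log (min (Fintype.card κ) (Fintype.card ι * Fintype.card μ) : ℝ) / Real.log 2) +
      θ 2 * (Real.log (min (Fintype.card μ) (Fintype.card ι * Fintype.card κ) : ℝ) / Real.log 2) := by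
  by_cases ht : t = 0
  · subst ht
    rw [quantumEntropy_zero]
    have hl : ∀ a b c : ℕ, 0 ≤ Real.log (min a (b * c) : ℝ) / Real.log 2 := fun a b c => by
      rw [← Nat.cast_mul, ← Nat.cast_min]
      exact div_nonneg (Real.log_natCast_nonneg _) (Real.log_nonneg one_le_two)
    exact add_nonneg (add_nonneg (mul_nonneg (hθ 0) (hl _ _ _)) (mul_nonneg (hθ 1) (hl _ _ _)))
      (mul_nonneg (hθ 2) (hl _ _ _))
  · exact add_le_add (add_le_add
      (mul_le_mul_of_nonneg_left (shannonEntropy_marginalSpectrum₁_le ht) (hθ 0))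
      (mul_le_mul_of_nonneg_left (shannonEntropy_marginalSpectrum₂_le ht) (hθ 1)))
      (mul_le_mul_of_nonneg_left (shannonEntropy_marginalSpectrum₃_le ht) (hθ 2))

/-- **CVZ Thm. 3.19.5 in logarithmic form**:
`E_θ(t) ≤ θ(1) log₂ min(|ι|,|κ||μ|) + θ(2) log₂ min(|κ|,|ι||μ|) + θ(3) log₂ min(|μ|,|ι||κ|)` for `θ ≥ 0`;
the bound on `H_θ` depends only on the format, so it passes to the supremum over `GL × GL × GL`.
[cite: ChristandlVranaZuiddam2023, Thm. 3.19.5] -/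
theorem logQuantumFunctional_le_log_min {θ : Fin 3 → ℝ} (hθ : ∀ i, 0 ≤ θ i) (t : ι → κ → μ → ℂ) :
    logQuantumFunctional θ t ≤
      θ 0 * (Real.log (min (Fintype.card ι) (Fintype.card κ * Fintype.card μ) : ℝ) / Real.log 2) +
      θ 1 * (Real.log (min (Fintype.card κ) (Fintype.card ι * Fintype.card μ) : ℝ) / Real.log 2) +
      θ 2 * (Real.log (min (Fintype.card μ) (Fintype.card ι * Fintype.card κ) : ℝ) / Real.log 2) :=
  ciSup_le fun _ => quantumEntropy_le_log_min hθ _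

end Marginals

/-! ## The named fact -/

section Fact

/-- **CVZ Thm. 3.19.5 holds** (case `k = 3`): for every `θ ∈ P([3])` and every complex 3-tensor `t`,
`0 ≤ F^θ(t) ≤ min(|ι|,|κ||μ|)^{θ(1)} · min(|κ|,|ι||μ|)^{θ(2)} · min(|μ|,|ι||κ|)^{θ(3)}`. Discharges the
named fact `ChristandlVranaZuiddam2023_bounds` of `QuantumFunctionals.lean`: `F^θ(0) = 0`; for `t ≠ 0`
all index types are nonempty, `F^θ(t) = 2^{E_θ(t)}`, and `logQuantumFunctional_le_log_min` is
exponentiated. [cite: ChristandlVranaZuiddam2023, Thm. 3.19.5] -/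
theorem ChristandlVranaZuiddam2023_bounds_holds : ChristandlVranaZuiddam2023_bounds.{u} := by
  intro θ hθ ι κ μ _ _ _ _ _ _ t
  refine ⟨quantumFunctional_nonneg θ t, ?_⟩
  by_cases ht : t = 0
  · subst ht
    rw [quantumFunctional_zero]
    positivity
  obtain ⟨a, b, c, -⟩ : ∃ a b c, t a b c ≠ 0 := by
    by_contra h
    push Not at h
    exact ht (funext fun a => funext fun b => funext fun c => h a b c)
  have hι : (1 : ℝ) ≤ Fintype.card ι := Nat.one_le_cast.2 (Fintype.card_pos_iff.2 ⟨a⟩)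
  have hκ : (1 : ℝ) ≤ Fintype.card κ := Nat.one_le_cast.2 (Fintype.card_pos_iff.2 ⟨b⟩)
  have hμ : (1 : ℝ) ≤ Fintype.card μ := Nat.one_le_cast.2 (Fintype.card_pos_iff.2 ⟨c⟩)
  have h₁ : (0 : ℝ) < (min (Fintype.card ι) (Fintype.card κ * Fintype.card μ) : ℝ) :=
    zero_lt_one.trans_le (le_min hι (one_le_mul_of_one_le_of_one_le hκ hμ))
  have h₂ : (0 : ℝ) < (min (Fintype.card κ) (Fintype.card ι * Fintype.card μ) : ℝ) :=
    zero_lt_one.trans_le (le_min hκ (one_le_mul_of_one_le_of_one_le hι hμ))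
  have h₃ : (0 : ℝ) < (min (Fintype.card μ) (Fintype.card ι * Fintype.card κ) : ℝ) :=
    zero_lt_one.trans_le (le_min hμ (one_le_mul_of_one_le_of_one_le hι hκ))
  rw [quantumFunctional_of_ne_zero θ ht]
  refine (Real.rpow_le_rpow_of_exponent_le one_le_two
    (logQuantumFunctional_le_log_min hθ.1 t)).trans_eq ?_
  rw [Real.rpow_add two_pos, Real.rpow_add two_pos, two_rpow_mul_log_div_log h₁,
    two_rpow_mul_log_div_log h₂, two_rpow_mul_log_div_log h₃]

end Fact

end Literature.Computability.AlgebraicComplexity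

end
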